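import Summits.CriticalPhenomena.PercolationContinuityZ3.Theorems.PercNearOneGluingNoHeavyLowerTailBlockQ9OneDangerousPort
import HarnessLib

/-!
# `NoHeavyLowerTail` (stmt-CriticalPhenomena-4575) — the BRANCHING IDENTITY of the exploration certificate for
# Kozma–Nitzan's Question 9: conditioning a glued block on one boundary pair

Support file (lemma factory `prim-lf-1` gen 7, coupling / BK–Harris technique; `--supports stmt-CriticalPhenomena-4575`).
No definitions, no named facts, no sorries.

Setting (`Fin n`, weights `u`): a block `O` (glued: every non-loop pair inside `O` has weight `1`, written
`glue_O u := fun e => if (∀ x ∈ e, x ∈ O) ∧ ¬ e.IsDiag then 1 else u e`), relays `A`, target `b`, anchor `a`, and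
one boundary pair `e = s(s₀, v)` with `s₀ ∈ O`, `v ∉ O`.  The value of the block for Question 9 is
`T(O, u) := μ_{glue_O u}(a ↔ b, O ↔ A) − μ_{glue_O u}(O ↔ b)` (memo `prim-lf-1/EC-NOTE.md`).

* `reachable_union_iff_of_joined` — adding pairs whose endpoints are already joined does not change reachability.
* `real_glue_inter_mem_eq` — OPEN branch: for events `Y, Y'` that agree after the internal pairs of `insert v O` are
  added to a configuration containing the internal pairs of `O` and `e`,
  `μ_{glue_O u}(Y ∩ {e open}) = u e · μ_{glue_{insert v O} u}(Y')`  (push-forwards `glueSet_pushforward`,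
  `UpsetExchange.real_forceOpen_inter`).
* `real_glue_inter_notMem_eq` — CLOSED branch: `μ_{glue_O u}(Y ∩ {e closed}) = (1 − u e) · μ_{glue_O u⁰}(Y)`,
  `u⁰ := u` with `e ↦ 0` (`BlockQ9.real_inter_notMem_eq`).
* `T_branch` — **the identity** `T(O, u) = u e · T(insert v O, u) + (1 − u e) · T(O, u⁰)` for the two events of
  Question 9 (`{a ↔ b} ∩ {O ↔ A}` and `{O ↔ b}`), written out in full.

With the leaves `blockQ9_of_reliableBlock` (L3, p193219), `blockThm4_general` (T4, this unit), `blockQ9_of_transfer`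
(M1, hp-1) and `UpsetExchange.upsetExchange_block` (UP, hp-1), this identity is the last ingredient needed to turn a
finite exploration certificate (EC-NOTE.md §3) for a given graph into a kernel-checked proof of (41) for that graph.
-/

namespace Summit.CriticalPhenomena.PercolationContinuityZ3.Theorems

open MeasureTheory Set ProbabilityTheory
open Literature.Probability.LatticeModels
open Literature.Probability.Percolation

noncomputable section
open Classical

namespace BlockQ9

variable {n : ℕ}

/-- Adding pairs whose endpoints are already joined by open paths does not change reachability. [folklore] -/
theorem reachable_union_iff_of_joined {ω : BondConfig (Fin n)} {F : Set (Sym2 (Fin n))}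
    (hF : ∀ f ∈ F, ∀ x ∈ f, ∀ y ∈ f, (openGraph ω).Reachable x y) (p q : Fin n) :
    (openGraph ((ω ∪ F : Set (Sym2 (Fin n))) : BondConfig (Fin n))).Reachable p q ↔
      (openGraph ω).Reachable p q := by
  constructor
  · intro h
    refine sigmaGeometry_reachable_of_adj (fun x y hxy => ?_) h
    rw [openGraph_adj] at hxy
    rcases hxy.1 with hω | hFmem
    · exact SimpleGraph.Adj.reachable ((openGraph_adj ω x y).2 ⟨hω, hxy.2⟩)
    · exact hF _ hFmem x (Sym2.mem_mk_left x y) y (Sym2.mem_mk_right x y)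
  · intro h
    refine h.mono ?_
    exact SimpleGraph.fromEdgeSet_mono subset_union_left

/-- **Open branch.**  `O` a block, `s₀ ∈ O`, `v ∉ O`, `e = s(s₀,v)`.  If the events `Y` (read in the `O`-glued world)
and `Y'` (read in the `insert v O`-glued world) agree in the sense that `ω ∈ Y ↔ ω ∪ D' ∈ Y'` for every `ω`
containing `e` and the non-loop pairs inside `O` (`D'` = the non-loop pairs inside `insert v O`), then
`μ_{glue_O u}(Y ∩ {e ∈ ω}) = u e · μ_{glue_{insert v O} u}(Y')`. [folklore; Grimmett 1999 §1.3] -/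
theorem real_glue_inter_mem_eq (u : Sym2 (Fin n) → unitInterval) (O : Finset (Fin n)) (s₀ v : Fin n)
    (hs₀ : s₀ ∈ O) (hv : v ∉ O) (Y Y' : Set (BondConfig (Fin n)))
    (hYY' : ∀ ω : BondConfig (Fin n), (∀ d : Sym2 (Fin n), (∀ x ∈ d, x ∈ O) → ¬ d.IsDiag → d ∈ ω) →
      s(s₀, v) ∈ ω →
      (ω ∈ Y ↔ ((ω ∪ {d | (∀ x ∈ d, x ∈ insert v O) ∧ ¬ d.IsDiag} : Set (Sym2 (Fin n))) : BondConfig (Fin n)) ∈ Y')) :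
    (prodBernoulli (fun d : Sym2 (Fin n) => if (∀ x ∈ d, x ∈ O) ∧ ¬ d.IsDiag then 1 else u d)).real
        (Y ∩ {ω | s(s₀, v) ∈ ω}) =
      (u s(s₀, v) : ℝ) *
        (prodBernoulli (fun d : Sym2 (Fin n) => if (∀ x ∈ d, x ∈ insert v O) ∧ ¬ d.IsDiag then 1 else u d)).real Y' := by
  classical
  set e : Sym2 (Fin n) := s(s₀, v) with he
  set D : Set (Sym2 (Fin n)) := {d | (∀ x ∈ d, x ∈ O) ∧ ¬ d.IsDiag} with hD
  set D' : Set (Sym2 (Fin n)) := {d | (∀ x ∈ d, x ∈ insert v O) ∧ ¬ d.IsDiag} with hD'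
  set g : Sym2 (Fin n) → unitInterval := fun d => if (∀ x ∈ d, x ∈ O) ∧ ¬ d.IsDiag then 1 else u d with hg
  set g' : Sym2 (Fin n) → unitInterval := fun d => if (∀ x ∈ d, x ∈ insert v O) ∧ ¬ d.IsDiag then 1 else u d
    with hg'
  set ue : Sym2 (Fin n) → unitInterval := fun d => if d = e then 1 else u d with hue
  have hsv : s₀ ≠ v := fun h => hv (h ▸ hs₀)
  have heD : e ∉ D := by
    rintro ⟨hO, -⟩
    exact hv (hO v (by rw [he]; exact Sym2.mem_mk_right s₀ v))
  have heD' : e ∈ D' := by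
    refine ⟨fun x hx => ?_, by rw [he, Sym2.mk_isDiag_iff]; exact hsv⟩
    rw [he] at hx
    rcases Sym2.mem_iff.1 hx with rfl | rfl
    · exact Finset.mem_insert_of_mem hs₀
    · exact Finset.mem_insert_self _ _
  have hDD' : D ⊆ D' := fun d hd => ⟨fun x hx => Finset.mem_insert_of_mem (hd.1 x hx), hd.2⟩
  -- (1) the `O`-glued measure as a push-forward of `μ_u` under `ω ↦ ω ∪ D`
  have h1 : (prodBernoulli g).real (Y ∩ {ω | e ∈ ω}) =
      (prodBernoulli u).real {ω : BondConfig (Fin n) | ((ω ∪ D : Set (Sym2 (Fin n))) : BondConfig (Fin n)) ∈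
        Y ∩ {ω | e ∈ ω}} :=
    glueSet_pushforward u g D (fun d hd => if_pos hd) (fun d hd => if_neg hd) _
  -- (2) rewrite the pulled-back event as `{e ∈ ω} ∩ {ω ∪ {e} ∈ Z}` with `Z := {ω | ω ∪ D ∈ Y}`
  have h2 : {ω : BondConfig (Fin n) | ((ω ∪ D : Set (Sym2 (Fin n))) : BondConfig (Fin n)) ∈ Y ∩ {ω | e ∈ ω}} =
      {ω : BondConfig (Fin n) | (↑({e} : Finset (Sym2 (Fin n))) : Set (Sym2 (Fin n))) ⊆ ω} ∩
        {ω : BondConfig (Fin n) | ((ω ∪ ↑({e} : Finset (Sym2 (Fin n))) : Set (Sym2 (Fin n))) : BondConfig (Fin n)) ∈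
          {ω' : BondConfig (Fin n) | ((ω' ∪ D : Set (Sym2 (Fin n))) : BondConfig (Fin n)) ∈ Y}} := by
    ext ω
    simp only [mem_setOf_eq, mem_inter_iff, Finset.coe_singleton, singleton_subset_iff, mem_union]
    constructor
    · rintro ⟨hY, heω | heD2⟩
      · refine ⟨heω, ?_⟩
        have : (ω ∪ {e} : Set (Sym2 (Fin n))) = ω := union_eq_self_of_subset_right (singleton_subset_iff.2 heω)
        rw [this]; exact hY
      · exact absurd heD2 heD
    · rintro ⟨heω, hY⟩
      have : (ω ∪ {e} : Set (Sym2 (Fin n))) = ω := union_eq_self_of_subset_right (singleton_subset_iff.2 heω)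
      rw [this] at hY
      exact ⟨hY, Or.inl heω⟩
  -- (3) force `e` open: factor `u e`, new weights `ue`
  have h3 := UpsetExchange.real_forceOpen_inter u ue ({e} : Finset (Sym2 (Fin n)))
    (fun d hd => by rw [Finset.mem_singleton] at hd; exact if_pos hd)
    (fun d hd => by rw [Finset.mem_singleton] at hd; exact if_neg hd)
    {ω' : BondConfig (Fin n) | ((ω' ∪ D : Set (Sym2 (Fin n))) : BondConfig (Fin n)) ∈ Y}
  rw [Finset.prod_singleton] at h3
  -- (4) `μ_{ue}` as a push-forward of `μ_u` under `ω ↦ ω ∪ {e}`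
  have h4 : (prodBernoulli ue).real {ω' : BondConfig (Fin n) | ((ω' ∪ D : Set (Sym2 (Fin n))) : BondConfig (Fin n)) ∈ Y} =
      (prodBernoulli u).real {ω : BondConfig (Fin n) | ((ω ∪ {e} : Set (Sym2 (Fin n))) : BondConfig (Fin n)) ∈
        {ω' : BondConfig (Fin n) | ((ω' ∪ D : Set (Sym2 (Fin n))) : BondConfig (Fin n)) ∈ Y}} :=
    glueSet_pushforward u ue {e} (fun d hd => by rw [mem_singleton_iff] at hd; exact if_pos hd)
      (fun d hd => by rw [mem_singleton_iff] at hd; exact if_neg hd) _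
  -- (5) the `insert v O`-glued measure as a push-forward of `μ_u` under `ω ↦ ω ∪ D'`
  have h5 : (prodBernoulli g').real Y' =
      (prodBernoulli u).real {ω : BondConfig (Fin n) | ((ω ∪ D' : Set (Sym2 (Fin n))) : BondConfig (Fin n)) ∈ Y'} :=
    glueSet_pushforward u g' D' (fun d hd => if_pos hd) (fun d hd => if_neg hd) _
  -- (6) the two pulled-back events coincide, by the agreement hypothesis
  have h6 : {ω : BondConfig (Fin n) | ((ω ∪ {e} : Set (Sym2 (Fin n))) : BondConfig (Fin n)) ∈
        {ω' : BondConfig (Fin n) | ((ω' ∪ D : Set (Sym2 (Fin n))) : BondConfig (Fin n)) ∈ Y}} =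
      {ω : BondConfig (Fin n) | ((ω ∪ D' : Set (Sym2 (Fin n))) : BondConfig (Fin n)) ∈ Y'} := by
    ext ω
    have hω₁ : ∀ d : Sym2 (Fin n), (∀ x ∈ d, x ∈ O) → ¬ d.IsDiag →
        d ∈ (((ω ∪ {e} : Set (Sym2 (Fin n))) ∪ D : Set (Sym2 (Fin n))) : BondConfig (Fin n)) :=
      fun d hd1 hd2 => Or.inr ⟨hd1, hd2⟩
    have hω₂ : e ∈ (((ω ∪ {e} : Set (Sym2 (Fin n))) ∪ D : Set (Sym2 (Fin n))) : BondConfig (Fin n)) :=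
      Or.inl (Or.inr rfl)
    have key := hYY' _ hω₁ hω₂
    have hset : (((ω ∪ {e} : Set (Sym2 (Fin n))) ∪ D : Set (Sym2 (Fin n))) ∪ D' : Set (Sym2 (Fin n))) =
        (ω ∪ D' : Set (Sym2 (Fin n))) := by
      ext d
      simp only [mem_union, mem_singleton_iff]
      constructor
      · intro h
        rcases h with ((h | h) | h) | h
        · exact Or.inl h
        · rw [h]; exact Or.inr heD'
        · exact Or.inr (hDD' h)
        · exact Or.inr h
      · intro h
        rcases h with h | h
        · exact Or.inl (Or.inl (Or.inl h))
        · exact Or.inr h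
    have key' : ((((ω ∪ {e} : Set (Sym2 (Fin n))) ∪ D : Set (Sym2 (Fin n))) : BondConfig (Fin n)) ∈ Y ↔
        ((ω ∪ D' : Set (Sym2 (Fin n))) : BondConfig (Fin n)) ∈ Y') := by
      rw [← hset]; exact key
    exact key'
  rw [h1, h2, h3, h4, h6, ← h5]

/-- **Closed branch.**  `μ_{glue_O u}(Y ∩ {e ∉ ω}) = (1 − u e) · μ_{glue_O u⁰}(Y)` with `u⁰ := u[e ↦ 0]`, for a pair
`e = s(s₀, v)` leaving the block (`v ∉ O`). [folklore; Grimmett 1999 §1.3] -/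
theorem real_glue_inter_notMem_eq (u : Sym2 (Fin n) → unitInterval) (O : Finset (Fin n)) (s₀ v : Fin n)
    (hv : v ∉ O) (Y : Set (BondConfig (Fin n))) :
    (prodBernoulli (fun d : Sym2 (Fin n) => if (∀ x ∈ d, x ∈ O) ∧ ¬ d.IsDiag then 1 else u d)).real
        (Y ∩ {ω | s(s₀, v) ∉ ω}) =
      (1 - (u s(s₀, v) : ℝ)) *
        (prodBernoulli (fun d : Sym2 (Fin n) => if (∀ x ∈ d, x ∈ O) ∧ ¬ d.IsDiag then 1 else
          (if d = s(s₀, v) then 0 else u d))).real Y := by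
  have hnot : ¬ ((∀ x ∈ s(s₀, v), x ∈ O) ∧ ¬ (s(s₀, v)).IsDiag) := fun h =>
    hv (h.1 v (Sym2.mem_mk_right s₀ v))
  have h := real_inter_notMem_eq
    (fun d : Sym2 (Fin n) => if (∀ x ∈ d, x ∈ O) ∧ ¬ d.IsDiag then 1 else u d)
    (fun d : Sym2 (Fin n) => if (∀ x ∈ d, x ∈ O) ∧ ¬ d.IsDiag then 1 else (if d = s(s₀, v) then 0 else u d))
    s(s₀, v) (by beta_reduce; rw [if_neg hnot, if_pos rfl]) (fun f hf => by beta_reduce; rw [if_neg hf]) Y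
  rw [h, if_neg hnot]

/-- Geometric agreement for the Question-9 events: if `ω` contains `e = s(s₀,v)` and the non-loop pairs inside `O`
(`s₀ ∈ O`), then adding the non-loop pairs inside `insert v O` changes no connection, `{O ↔ X}` becomes
`{insert v O ↔ X}`, and `{a ↔ b}` is unchanged. [folklore] -/
theorem branch_events_agree {ω : BondConfig (Fin n)} {O : Finset (Fin n)} {s₀ v : Fin n} (hs₀ : s₀ ∈ O)
    (hD : ∀ d : Sym2 (Fin n), (∀ x ∈ d, x ∈ O) → ¬ d.IsDiag → d ∈ ω) (he : s(s₀, v) ∈ ω) (X : Finset (Fin n))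
    (a b : Fin n) :
    ((ω ∈ (openConn a b : Set (BondConfig (Fin n))) ↔
        ((ω ∪ {d | (∀ x ∈ d, x ∈ insert v O) ∧ ¬ d.IsDiag} : Set (Sym2 (Fin n))) : BondConfig (Fin n)) ∈
          (openConn a b : Set (BondConfig (Fin n)))) ∧
      ((ω ∈ ⋃ o ∈ O, ⋃ x ∈ X, (openConn o x : Set (BondConfig (Fin n)))) ↔
        ((ω ∪ {d | (∀ x ∈ d, x ∈ insert v O) ∧ ¬ d.IsDiag} : Set (Sym2 (Fin n))) : BondConfig (Fin n)) ∈
          ⋃ o ∈ insert v O, ⋃ x ∈ X, (openConn o x : Set (BondConfig (Fin n))))) := by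
  set F : Set (Sym2 (Fin n)) := {d | (∀ x ∈ d, x ∈ insert v O) ∧ ¬ d.IsDiag} with hF
  -- every member of `insert v O` is joined to `s₀` in `ω`
  have hjoin : ∀ x ∈ insert v O, (openGraph ω).Reachable s₀ x := by
    intro x hx
    rcases Finset.mem_insert.1 hx with rfl | hxO
    · by_cases hsx : s₀ = x
      · subst hsx; exact SimpleGraph.Reachable.refl _
      · exact SimpleGraph.Adj.reachable ((openGraph_adj ω s₀ x).2 ⟨he, hsx⟩)
    · by_cases hsx : s₀ = x
      · subst hsx; exact SimpleGraph.Reachable.refl _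
      · refine SimpleGraph.Adj.reachable ((openGraph_adj ω s₀ x).2 ⟨?_, hsx⟩)
        exact hD _ (fun y hy => by rcases Sym2.mem_iff.1 hy with rfl | rfl <;> assumption)
          (by rw [Sym2.mk_isDiag_iff]; exact hsx)
  have hFj : ∀ f ∈ F, ∀ x ∈ f, ∀ y ∈ f, (openGraph ω).Reachable x y := by
    intro f hf x hx y hy
    exact ((hjoin x (hf.1 x hx)).symm).trans (hjoin y (hf.1 y hy))
  have hR : ∀ p q : Fin n, (openGraph ((ω ∪ F : Set (Sym2 (Fin n))) : BondConfig (Fin n))).Reachable p q ↔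
      (openGraph ω).Reachable p q := reachable_union_iff_of_joined hFj
  refine ⟨?_, ?_⟩
  · show (openGraph ω).Reachable a b ↔ (openGraph ((ω ∪ F : Set (Sym2 (Fin n))) : BondConfig (Fin n))).Reachable a b
    rw [hR]
  · simp only [mem_iUnion]
    constructor
    · rintro ⟨o, ho, x, hx, hox⟩
      refine ⟨o, Finset.mem_insert_of_mem ho, x, hx, ?_⟩
      show (openGraph ((ω ∪ F : Set (Sym2 (Fin n))) : BondConfig (Fin n))).Reachable o x
      rw [hR]; exact hox
    · rintro ⟨o, ho, x, hx, hox⟩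
      have hox' : (openGraph ω).Reachable o x := (hR o x).1 hox
      exact ⟨s₀, hs₀, x, hx, (hjoin o ho).trans hox'⟩

/-- **The branching identity of the exploration certificate.**  For a block `O`, relays `A`, vertices `a, b`,
weights `u` and a boundary pair `e = s(s₀, v)` (`s₀ ∈ O`, `v ∉ O`), writing `glue_S u` for `u` with the non-loop
pairs inside `S` raised to `1` and `u⁰ := u[e ↦ 0]`:
`[μ_{glue_O u}(a↔b, O↔A) − μ_{glue_O u}(O↔b)] = u e · [μ_{glue_{O+v} u}(a↔b, (O+v)↔A) − μ_{glue_{O+v} u}((O+v)↔b)]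
 + (1 − u e) · [μ_{glue_O u⁰}(a↔b, O↔A) − μ_{glue_O u⁰}(O↔b)]`  (condition on the pair `e`).
[this work; folklore bookkeeping, Grimmett 1999 §1.3] -/
theorem T_branch (u : Sym2 (Fin n) → unitInterval) (O A : Finset (Fin n)) (a b s₀ v : Fin n)
    (hs₀ : s₀ ∈ O) (hv : v ∉ O) :
    (prodBernoulli (fun d : Sym2 (Fin n) => if (∀ x ∈ d, x ∈ O) ∧ ¬ d.IsDiag then 1 else u d)).real
        (openConn a b ∩ ⋃ o ∈ O, ⋃ x ∈ A, openConn o x) -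
      (prodBernoulli (fun d : Sym2 (Fin n) => if (∀ x ∈ d, x ∈ O) ∧ ¬ d.IsDiag then 1 else u d)).real
        (⋃ o ∈ O, openConn o b) =
    (u s(s₀, v) : ℝ) *
      ((prodBernoulli (fun d : Sym2 (Fin n) => if (∀ x ∈ d, x ∈ insert v O) ∧ ¬ d.IsDiag then 1 else u d)).real
          (openConn a b ∩ ⋃ o ∈ insert v O, ⋃ x ∈ A, openConn o x) -
        (prodBernoulli (fun d : Sym2 (Fin n) => if (∀ x ∈ d, x ∈ insert v O) ∧ ¬ d.IsDiag then 1 else u d)).real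
          (⋃ o ∈ insert v O, openConn o b)) +
    (1 - (u s(s₀, v) : ℝ)) *
      ((prodBernoulli (fun d : Sym2 (Fin n) => if (∀ x ∈ d, x ∈ O) ∧ ¬ d.IsDiag then 1 else
          (if d = s(s₀, v) then 0 else u d))).real (openConn a b ∩ ⋃ o ∈ O, ⋃ x ∈ A, openConn o x) -
        (prodBernoulli (fun d : Sym2 (Fin n) => if (∀ x ∈ d, x ∈ O) ∧ ¬ d.IsDiag then 1 else
          (if d = s(s₀, v) then 0 else u d))).real (⋃ o ∈ O, openConn o b)) := by
  classical
  set g : Sym2 (Fin n) → unitInterval := fun d => if (∀ x ∈ d, x ∈ O) ∧ ¬ d.IsDiag then 1 else u d with hg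
  set YA : Set (BondConfig (Fin n)) := openConn a b ∩ ⋃ o ∈ O, ⋃ x ∈ A, openConn o x with hYA
  set YB : Set (BondConfig (Fin n)) := ⋃ o ∈ O, openConn o b with hYB
  set YA' : Set (BondConfig (Fin n)) := openConn a b ∩ ⋃ o ∈ insert v O, ⋃ x ∈ A, openConn o x with hYA'
  set YB' : Set (BondConfig (Fin n)) := ⋃ o ∈ insert v O, openConn o b with hYB'
  -- split both `O`-glued masses along `{e ∈ ω}` / `{e ∉ ω}`
  have hsplit : ∀ Y : Set (BondConfig (Fin n)), (prodBernoulli g).real Y =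
      (prodBernoulli g).real (Y ∩ {ω | s(s₀, v) ∈ ω}) + (prodBernoulli g).real (Y ∩ {ω | s(s₀, v) ∉ ω}) := by
    intro Y
    rw [← measureReal_inter_add_sdiff (s := Y) (MeasurableSet.of_discrete : MeasurableSet {ω | s(s₀, v) ∈ ω})
      (measure_ne_top _ _)]
    rfl
  -- open branch for the two events
  have hA := real_glue_inter_mem_eq u O s₀ v hs₀ hv YA YA' (fun ω hD he => by
    obtain ⟨h1, h2⟩ := branch_events_agree hs₀ hD he A a b
    simp only [hYA, hYA', mem_inter_iff]
    exact and_congr h1 h2)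
  have hB := real_glue_inter_mem_eq u O s₀ v hs₀ hv YB YB' (fun ω hD he => by
    obtain ⟨-, h2⟩ := branch_events_agree hs₀ hD he {b} a b
    simp only [Finset.mem_singleton, iUnion_iUnion_eq_left] at h2
    simpa only [hYB, hYB'] using h2)
  -- closed branch for the two events
  have hA0 := real_glue_inter_notMem_eq u O s₀ v hv YA
  have hB0 := real_glue_inter_notMem_eq u O s₀ v hv YB
  rw [hsplit YA, hsplit YB, hA, hB, hA0, hB0]
  ring

end BlockQ9

end

end Summit.CriticalPhenomena.PercolationContinuityZ3.Theorems
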